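import Mathlib.Analysis.Calculus.Deriv.MeanValue
import Summits.AnomalousDissipation.AnomalousDissipation.Theorems.TwoAndHalfDScalarAnomalySteadySourceFormalColdStartVarianceToolkit
import HarnessLib

/-!
# Cold-start input-power floor for the sourced passive scalar (short-time Green–Kubo floor)

Support file for the tool stub `stub_coldStartCorrelationFloor` of the line
`budgeted-mixer-template` for the crux `TwoAndHalfD.ScalarAnomalySteadySourceFormal`
(stmt-AnomalousDissipation-0448). For the classical cold start `θ` of the sourced
advection–diffusion equation `∂ₜθ + u·∇θ = κΔθ + h` on `[s, s + L] × T^d` (`θ(s) = 0`, `κ ≥ 0`,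
steady smooth source `h`) over a smooth divergence-free drift with `∫ |u(t)|² ≤ E`, and a profile
with `|∇h| ≤ G`, `‖Δh‖_{L²} ≤ M`, the source–scalar correlation obeys the universal short-time
floor

`∫ h θ(s + L) ≥ L‖h‖² − (L²/2) ‖h‖ (G√E + κM)`   (`‖h‖ = (∫ h²)^{1/2}`).

Contents (all elementary calculus of classical solutions):

* `hasDerivWithinAt_integral_mul` — the correlation balance
  `d/dt ∫ h θ = ‖h‖² + κ ∫ (Δh) θ + ∫ ⟪u, ∇h⟫ θ` (differentiate under the integral, insert the
  equation, Green's second identity `∫ h Δθ = ∫ (Δh) θ` and the incompressible integration by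
  parts `∫ h ⟪u, ∇θ⟫ = -∫ ⟪u, ∇h⟫ θ`);
* `neg_sqrt_mul_sqrt_le_integral_mul` — the lower Cauchy–Schwarz bound `-‖f‖‖g‖ ≤ ∫ f g`;
* `sqrt_integral_inner_sq_le` — `‖⟪u, ∇h⟫‖_{L²} ≤ G (∫|u|²)^{1/2}`;
* `correlation_floor` — the floor itself: the balance, the two `L²` bounds and the cold-start
  estimate `‖θ(t)‖ ≤ (t − s)‖h‖` (`ColdStartVariance.sqrt_scalarL2Sq_le_of_coldStart`) give
  `(∫ h θ)' ≥ ‖h‖² − (t − s)‖h‖(G√E + κM)`, which is integrated by monotonicity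
  (Mathlib `monotoneOn_of_hasDerivWithinAt_nonneg`);
* `stub_coldStartCorrelationFloor` — the registered `∀`-form on `T²`.

Supports stmt-AnomalousDissipation-0448. [folklore: Doering–Foias 2002 §2 (power input
`∫ θ s`); Shaw–Thiffeault–Doering 2007, (I.11)]
-/

-- the summit path `AnomalousDissipation/AnomalousDissipation` duplicates a namespace component
set_option linter.dupNamespace false

noncomputable section

namespace Summit.AnomalousDissipation.AnomalousDissipation.Theorems.ScalarAnomalySteadySourceFormal.ColdStartCorrelationFloor

open MeasureTheory Filter Topology Set
open scoped ENNReal NNReal RealInnerProductSpace InnerProductSpace ContDiff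
open Literature.Analysis.FunctionSpaces Literature.Analysis.FluidPDE
open Summit.AnomalousDissipation.AnomalousDissipation.Theorems.ScalarAnomalySteadySourceFormal.ColdStartVariance

variable {d : Type*} [Fintype d] [DecidableEq d]

/-! ## The correlation balance -/

section Balance

variable {S : Set ℝ} {κ : ℝ} {u : ℝ → UnitAddTorus d → EuclideanSpace ℝ d}
  {hsrc : UnitAddTorus d → ℝ} {θ : ℝ → UnitAddTorus d → ℝ}

/-- **The correlation balance.** For a classical solution of `∂ₜθ + u·∇θ = κΔθ + h` with a
steady source `h` on a convex time set `S`,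
`d/dt ∫ h θ(t) = ‖h‖²_{L²} + κ ∫ (Δh) θ(t) + ∫ ⟪u(t), ∇h⟫ θ(t)` within `S` (differentiate under
`∫_{T^d}`, insert the equation, and integrate by parts twice on the torus: `∫ h Δθ = ∫ (Δh) θ`,
Green's second identity, and `∫ h ⟪u, ∇θ⟫ = -∫ ⟪u, ∇h⟫ θ` for divergence-free `u`; Doering–Foias
2002, §2: power input `∫ θ s`). At an isolated point of `S` the statement is vacuous. [folklore] -/
theorem hasDerivWithinAt_integral_mul
    (h : Torus.IsClassicalScalarTransportForcedOn S κ u (fun _ => hsrc) θ) (hS : Convex ℝ S)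
    {t : ℝ} (ht : t ∈ S) :
    HasDerivWithinAt (fun τ => ∫ x, hsrc x * θ τ x)
      (Torus.scalarL2Sq hsrc + κ * (∫ x, Torus.laplacian hsrc x * θ t x) +
        ∫ x, ⟪u t x, Torus.gradient hsrc x⟫_ℝ * θ t x) S t := by
  by_cases hacc : AccPt t (𝓟 S)
  swap
  · exact HasFDerivWithinAt.of_not_accPt hacc
  have hU : UniqueDiffOn ℝ S :=
    uniqueDiffOn_convex hS (Torus.interior_nonempty_of_convex_of_accPt hS ht hacc)
  have hθs := h.smooth_scalar
  have hθt : Torus.IsSmooth (θ t) := hθs.isSmooth_slice ht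
  have hut : Torus.IsSmooth (u t) := h.smooth_velocity.isSmooth_slice ht
  have hsm : Torus.IsSmooth hsrc := h.smooth_source.isSmooth_slice ht
  -- differentiate `∫ h θ` under the integral sign
  have hφ : Torus.IsSmoothSpaceTimeOn S (fun τ x => hsrc x * θ τ x) :=
    (Torus.isSmoothSpaceTimeOn_const hsm S).mul hθs
  have hE := hφ.hasDerivWithinAt_integral hS ht
  refine hE.congr_deriv ?_
  have htd : ∀ x, Torus.timeDerivWithin S (fun τ x => hsrc x * θ τ x) t x =
      hsrc x * Torus.timeDerivWithin S θ t x := by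
    intro x
    have h2 : HasDerivWithinAt (fun τ => hsrc x * θ τ x)
        (hsrc x * Torus.timeDerivWithin S θ t x) S t :=
      (hθs.hasDerivWithinAt_slice ht x).const_mul (hsrc x)
    exact h2.derivWithin (hU t ht)
  -- insert the equation
  have hpt : (fun x => Torus.timeDerivWithin S (fun τ x => hsrc x * θ τ x) t x) =
      fun x => (hsrc x ^ 2 + κ * (hsrc x * Torus.laplacian (θ t) x)) -
        hsrc x * ⟪u t x, Torus.gradient (θ t) x⟫_ℝ := by
    funext x
    rw [htd x]
    have := h.transport t ht x
    have hre : Torus.timeDerivWithin S θ t x = κ * Torus.laplacian (θ t) x -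
        ⟪u t x, Torus.gradient (θ t) x⟫_ℝ + hsrc x := by linarith
    rw [hre]
    ring
  have i0 : Integrable (fun x => hsrc x ^ 2) volume := (hsm.continuous.pow 2).integrable_unitAddTorus
  have i1 : Integrable (fun x => hsrc x * Torus.laplacian (θ t) x) volume :=
    (hsm.smul' hθt.laplacian).integrable
  have i01 : Integrable (fun x => hsrc x ^ 2 + κ * (hsrc x * Torus.laplacian (θ t) x)) volume :=
    i0.add (i1.const_mul κ)
  have i2 : Integrable (fun x => hsrc x * ⟪u t x, Torus.gradient (θ t) x⟫_ℝ) volume :=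
    (hsm.smul' (hut.inner hθt.gradient)).integrable
  -- the two integrations by parts
  have hibp := Torus.integral_mul_inner_gradient_add_eq_zero hut (h.divFree t ht) hsm hθt
  rw [hpt, integral_sub i01 i2, integral_add i0 (i1.const_mul κ),
    integral_const_mul, Torus.integral_mul_laplacian_comm_holds hsm hθt]
  simp only [Torus.scalarL2Sq]
  linarith

end Balance

/-! ## Two `L²` bounds -/

section Inequalities

omit [DecidableEq d] in
/-- Lower Cauchy–Schwarz bound in `L²(T^d)`: `-(∫ f²)^{1/2} (∫ g²)^{1/2} ≤ ∫ f g` for smooth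
`f`, `g` (Cauchy–Schwarz applied to `-f` and `g`). [folklore] -/
theorem neg_sqrt_mul_sqrt_le_integral_mul {f g : UnitAddTorus d → ℝ} (hf : Torus.IsSmooth f)
    (hg : Torus.IsSmooth g) :
    -(√(∫ x, f x ^ 2) * √(∫ x, g x ^ 2)) ≤ ∫ x, f x * g x := by
  have h := integral_mul_le_sqrt_mul_sqrt (f := fun x => -f x) ((hf.memLp 2).neg) (hg.memLp 2)
  simp only [neg_mul, integral_neg, neg_sq] at h
  linarith

omit [DecidableEq d] in
/-- `‖⟪u, ∇h⟫‖_{L²} ≤ G · (∫ |u|²)^{1/2}`-type bound: if `|∇h| ≤ G` pointwise and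
`∫ |u|² ≤ E`, then `(∫ ⟪u, ∇h⟫²)^{1/2} ≤ G √E` (pointwise Cauchy–Schwarz
`|⟪u, ∇h⟫| ≤ |u| |∇h| ≤ G|u|`, monotonicity of the integral and of the square root). [folklore] -/
theorem sqrt_integral_inner_sq_le {u : UnitAddTorus d → EuclideanSpace ℝ d}
    {hsrc : UnitAddTorus d → ℝ} {E G : ℝ} (hu : Torus.IsSmooth u) (hh : Torus.IsSmooth hsrc)
    (hE : ∫ x, ‖u x‖ ^ 2 ≤ E) (hG : ∀ x, ‖Torus.gradient hsrc x‖ ≤ G) (hG0 : 0 ≤ G) :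
    √(∫ x, ⟪u x, Torus.gradient hsrc x⟫_ℝ ^ 2) ≤ G * √E := by
  have h1 : ∫ x, ⟪u x, Torus.gradient hsrc x⟫_ℝ ^ 2 ≤ ∫ x, G ^ 2 * ‖u x‖ ^ 2 := by
    refine integral_mono (((hu.inner hh.gradient).continuous.pow 2).integrable_unitAddTorus)
      (hu.norm_sq.integrable.const_mul (G ^ 2)) fun x => ?_
    have hx : |⟪u x, Torus.gradient hsrc x⟫_ℝ| ≤ ‖u x‖ * G :=
      (abs_real_inner_le_norm _ _).trans (mul_le_mul_of_nonneg_left (hG x) (norm_nonneg _))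
    have hx2 := pow_le_pow_left₀ (abs_nonneg _) hx 2
    rw [sq_abs] at hx2
    calc ⟪u x, Torus.gradient hsrc x⟫_ℝ ^ 2 ≤ (‖u x‖ * G) ^ 2 := hx2
      _ = G ^ 2 * ‖u x‖ ^ 2 := by ring
  rw [integral_const_mul] at h1
  have h2 : G ^ 2 * ∫ x, ‖u x‖ ^ 2 ≤ G ^ 2 * E := mul_le_mul_of_nonneg_left hE (sq_nonneg G)
  calc √(∫ x, ⟪u x, Torus.gradient hsrc x⟫_ℝ ^ 2) ≤ √(G ^ 2 * E) := Real.sqrt_le_sqrt (h1.trans h2)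
    _ = G * √E := by rw [Real.sqrt_mul (sq_nonneg G), Real.sqrt_sq hG0]

end Inequalities

/-! ## The cold-start correlation floor -/

section Floor

variable {κ s L E G M : ℝ} {u : ℝ → UnitAddTorus d → EuclideanSpace ℝ d}
  {hsrc : UnitAddTorus d → ℝ} {θ : ℝ → UnitAddTorus d → ℝ}

/-- **Cold-start input-power floor.** A classical solution `θ` of `∂ₜθ + u·∇θ = κΔθ + h` on
`[s, s + L] × T^d` (`κ ≥ 0`, `L > 0`, steady smooth source `h`) with `θ(s) = 0`, over a smooth
divergence-free drift with `∫ |u(t)|² ≤ E` (no sign condition on `E` is needed: the hypothesis is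
vacuous for `E < 0`) and a profile with `|∇h| ≤ G`, `‖Δh‖_{L²} ≤ M`,
satisfies `∫ h θ(s + L) ≥ L‖h‖² − (L²/2)‖h‖(G√E + κM)`: by the correlation balance and the two
`L²` bounds, `(∫ h θ)' ≥ ‖h‖² − ‖θ(t)‖(G√E + κM)`, and the cold-start estimate
`‖θ(t)‖ ≤ (t − s)‖h‖` makes `t ↦ ∫ h θ(t) − (t − s)‖h‖² + ((t − s)²/2)‖h‖(G√E + κM)`
non-decreasing on `[s, s + L]` (Mathlib `monotoneOn_of_hasDerivWithinAt_nonneg`); it vanishes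
at `t = s`. (Doering–Foias 2002, §2; the universal short-time part of the Green–Kubo power
integral.) [folklore] -/
theorem correlation_floor (hκ : 0 ≤ κ) (hL : 0 < L)
    (hθ : Torus.IsClassicalScalarTransportForcedOn (Icc s (s + L)) κ u (fun _ => hsrc) θ)
    (h0 : θ s = fun _ => 0) (hEn : ∀ t ∈ Icc s (s + L), ∫ x, ‖u t x‖ ^ 2 ≤ E)
    (hG : ∀ x, ‖Torus.gradient hsrc x‖ ≤ G)
    (hM : √(Torus.scalarL2Sq (Torus.laplacian hsrc)) ≤ M) :
    L * Torus.scalarL2Sq hsrc - L ^ 2 / 2 * √(Torus.scalarL2Sq hsrc) * (G * √E + κ * M) ≤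
      ∫ x, hsrc x * θ (s + L) x := by
  set N : ℝ := √(Torus.scalarL2Sq hsrc)
  set K : ℝ := G * √E + κ * M with hK_def
  have hsI : s ∈ Icc s (s + L) := left_mem_Icc.2 (by linarith)
  have hLI : s + L ∈ Icc s (s + L) := right_mem_Icc.2 (by linarith)
  have hsm : Torus.IsSmooth hsrc := hθ.smooth_source.isSmooth_slice hsI
  have hN2 : N ^ 2 = Torus.scalarL2Sq hsrc := Real.sq_sqrt (Torus.scalarL2Sq_nonneg _)
  have hG0 : 0 ≤ G := (norm_nonneg _).trans (hG 0)
  have hM0 : 0 ≤ M := (Real.sqrt_nonneg _).trans hM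
  have hK : 0 ≤ K := add_nonneg (mul_nonneg hG0 (Real.sqrt_nonneg _)) (mul_nonneg hκ hM0)
  -- the correlation balance and the lower bound on its right-hand side
  set D : ℝ → ℝ := fun τ => Torus.scalarL2Sq hsrc + κ * (∫ x, Torus.laplacian hsrc x * θ τ x) +
    ∫ x, ⟪u τ x, Torus.gradient hsrc x⟫_ℝ * θ τ x with hD_def
  have hder : ∀ τ ∈ Icc s (s + L),
      HasDerivWithinAt (fun τ => ∫ x, hsrc x * θ τ x) (D τ) (Icc s (s + L)) τ :=
    fun τ hτ => hasDerivWithinAt_integral_mul hθ (convex_Icc _ _) hτ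
  have hbound : ∀ τ ∈ Icc s (s + L), N ^ 2 - (τ - s) * N * K ≤ D τ := by
    intro τ hτ
    have hθτ : Torus.IsSmooth (θ τ) := hθ.smooth_scalar.isSmooth_slice hτ
    have huτ : Torus.IsSmooth (u τ) := hθ.smooth_velocity.isSmooth_slice hτ
    set P : ℝ := √(Torus.scalarL2Sq (θ τ))
    have hP0 : 0 ≤ P := Real.sqrt_nonneg _
    have hcold : P ≤ (τ - s) * N := sqrt_scalarL2Sq_le_of_coldStart hκ (by linarith) hθ h0 hτ
    have h1 : -(√(Torus.scalarL2Sq (Torus.laplacian hsrc)) * P) ≤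
        ∫ x, Torus.laplacian hsrc x * θ τ x :=
      neg_sqrt_mul_sqrt_le_integral_mul hsm.laplacian hθτ
    have h2 : -(√(∫ x, ⟪u τ x, Torus.gradient hsrc x⟫_ℝ ^ 2) * P) ≤
        ∫ x, ⟪u τ x, Torus.gradient hsrc x⟫_ℝ * θ τ x :=
      neg_sqrt_mul_sqrt_le_integral_mul (huτ.inner hsm.gradient) hθτ
    have h3 : √(∫ x, ⟪u τ x, Torus.gradient hsrc x⟫_ℝ ^ 2) ≤ G * √E :=
      sqrt_integral_inner_sq_le huτ hsm (hEn τ hτ) hG hG0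
    have h1' : -(M * P) ≤ ∫ x, Torus.laplacian hsrc x * θ τ x :=
      le_trans (neg_le_neg (mul_le_mul_of_nonneg_right hM hP0)) h1
    have h1'' : κ * -(M * P) ≤ κ * ∫ x, Torus.laplacian hsrc x * θ τ x :=
      mul_le_mul_of_nonneg_left h1' hκ
    have h2' : -(G * √E * P) ≤ ∫ x, ⟪u τ x, Torus.gradient hsrc x⟫_ℝ * θ τ x :=
      le_trans (neg_le_neg (mul_le_mul_of_nonneg_right h3 hP0)) h2
    have hPK : P * K ≤ (τ - s) * N * K := mul_le_mul_of_nonneg_right hcold hK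
    have hDτ : D τ = N ^ 2 + κ * (∫ x, Torus.laplacian hsrc x * θ τ x) +
        ∫ x, ⟪u τ x, Torus.gradient hsrc x⟫_ℝ * θ τ x := by
      simp only [hD_def, hN2]
    rw [hDτ]
    have hPK' : P * K = G * √E * P + κ * (M * P) := by simp only [hK_def]; ring
    linarith
  -- `g(t) = ∫ h θ(t) + ((t - s)²/2) N K - (t - s) N²` is non-decreasing on `[s, s + L]`
  have hpoly : ∀ τ, HasDerivAt (fun τ => (τ - s) * (τ - s) / 2 * (N * K) - (τ - s) * N ^ 2)
      ((τ - s) * (N * K) - N ^ 2) τ := by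
    intro τ
    have h1 : HasDerivAt (fun τ => τ - s) 1 τ := (hasDerivAt_id τ).sub_const s
    have h2 := (((h1.fun_mul h1).div_const 2).mul_const (N * K)).fun_sub (h1.mul_const (N ^ 2))
    refine h2.congr_deriv ?_
    ring
  set g : ℝ → ℝ := fun τ => (∫ x, hsrc x * θ τ x) +
    ((τ - s) * (τ - s) / 2 * (N * K) - (τ - s) * N ^ 2) with hg_def
  have hfcont : ContinuousOn (fun τ => ∫ x, hsrc x * θ τ x) (Icc s (s + L)) :=
    fun τ hτ => (hder τ hτ).continuousWithinAt
  have hgcont : ContinuousOn g (Icc s (s + L)) :=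
    hfcont.add fun τ _ => (hpoly τ).continuousAt.continuousWithinAt
  have hgder : ∀ τ ∈ interior (Icc s (s + L)),
      HasDerivWithinAt g (D τ + ((τ - s) * (N * K) - N ^ 2)) (interior (Icc s (s + L))) τ :=
    fun τ hτ =>
      ((hder τ (interior_subset hτ)).fun_add (hpoly τ).hasDerivWithinAt).mono interior_subset
  have hgpos : ∀ τ ∈ interior (Icc s (s + L)), 0 ≤ D τ + ((τ - s) * (N * K) - N ^ 2) := by
    intro τ hτ
    have := hbound τ (interior_subset hτ)
    linarith
  have hmono := monotoneOn_of_hasDerivWithinAt_nonneg (convex_Icc s (s + L)) hgcont hgder hgpos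
  have hle : g s ≤ g (s + L) := hmono hsI hLI (by linarith)
  have hfs : ∫ x, hsrc x * θ s x = 0 := by
    rw [h0]
    simp
  have hgs : g s = 0 := by
    simp only [hg_def]
    rw [hfs]
    ring
  have hgL : g (s + L) = (∫ x, hsrc x * θ (s + L) x) + (L * L / 2 * (N * K) - L * N ^ 2) := by
    simp only [hg_def]
    ring
  rw [hgs, hgL] at hle
  rw [← hN2]
  linarith

end Floor

/-! ## Registered form -/

/-- **Tool stub `stub_coldStartCorrelationFloor`** (short-time input-power floor of a cold
start, registered sub-goal of stmt-AnomalousDissipation-0448 for the line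
`budgeted-mixer-template`): for the classical cold start `θ'` of `∂ₜθ + u·∇θ = κΔθ + h` on
`[s, s + L] × T²` (`θ'(s) = 0`) over a smooth divergence-free drift with `∫ |u(t)|² ≤ E`, and a
smooth profile with `|∇h| ≤ G`, `‖Δh‖_{L²} ≤ M`:
`∫ h θ'(s + L) ≥ L‖h‖² − (L²/2)‖h‖(G√E + κM)` (`‖h‖ = √(scalarL2Sq h)`; `correlation_floor`).
[folklore] -/
theorem stub_coldStartCorrelationFloor :
    ∀ (κ s L E G M : ℝ) (u : ℝ → UnitAddTorus (Fin 2) → EuclideanSpace ℝ (Fin 2))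
      (h : UnitAddTorus (Fin 2) → ℝ) (θ' : ℝ → UnitAddTorus (Fin 2) → ℝ),
      0 ≤ κ → 0 < L → 0 ≤ E →
      Torus.IsClassicalScalarTransportForcedOn (Set.Icc s (s + L)) κ u (fun _ => h) θ' →
      θ' s = (fun _ => (0 : ℝ)) →
      Torus.IsSmooth h →
      (∀ t ∈ Set.Icc s (s + L), ∫ x, ‖u t x‖ ^ 2 ≤ E) →
      (∀ x, ‖Torus.gradient h x‖ ≤ G) →
      Real.sqrt (Torus.scalarL2Sq (Torus.laplacian h)) ≤ M →
      L * Torus.scalarL2Sq h - L ^ 2 / 2 * Real.sqrt (Torus.scalarL2Sq h) * (G * Real.sqrt E + κ * M)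
        ≤ ∫ x, h x * θ' (s + L) x :=
  fun _ _ _ _ _ _ _ _ _ hκ hL _ hθ h0 _ hEn hG hM => correlation_floor hκ hL hθ h0 hEn hG hM

end Summit.AnomalousDissipation.AnomalousDissipation.Theorems.ScalarAnomalySteadySourceFormal.ColdStartCorrelationFloor

end
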